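import Summits.BirchSwinnertonDyer.BirchSwinnertonDyer.Theorems.SignedLowerHalvesSprungLowerDivisibilityAtThreeIotaDescent
import HarnessLib

/-!
# Crux `SprungLowerDivisibilityAtThree` (item stmt-BirchSwinnertonDyer-19875), line `chromatic-common-zeros`:
# the ι-TRACE SPLIT of `Λ = ℤ_p⟦T⟧` along `Y = T + ι(T) = T²(1+T)⁻¹` and its DEGREE-ONE RESULTANT — «no ι-pair of zeros
# off (p), (T)» from ONE `p`-adic inequality `|M₀(M₂+M₃) − M₁M₂| > |M₀|²` (pure algebra, `p ≠ 2`)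

Cell `bsd-ssimc` (host) / lead `cruxlead-stmt-BirchSwinnertonDyer-19875`; width seat `-w2` (gen 6); `--supports` 19875
`--as helper`; THEOREMS ONLY (no definition, no named fact, nothing about any curve); closes no item; BSD / K1 / leaf X8 are
NOT proved by anything here. The X8 doors fed by this file are in `…IotaTraceLinearDoor.lean`.

## The mechanism (w2 g6; sequel of w2 g5 `…IotaDescentAlgebra` and w3 g5 `…IotaSharpOfFlat`)

`ι : T ↦ (1+T)⁻¹ − 1` fixes `Y := T + ι(T) = T²(1+T)⁻¹`, and `T·ι(T) = −Y`; so every `M ∈ Λ` satisfies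
`M ≡ 𝒜 + T·ℬ (mod Y²Λ)` with the ι-INVARIANT linear parts `𝒜 = M₀ + M₂Y`, `ℬ = M₁ + (M₂ + M₃)Y` (`M_k` the coefficients of
`M`; `T² ≡ Y + YT`, `T³ ≡ YT`, `T⁴ ∈ Y²Λ`), and `M∘ι ≡ 𝒜 + ι(T)·ℬ`. If a prime `𝔭 ∌ T` contains `M` and `M∘ι`, then
(`T − ι(T) = T·(2 + ι(T))`, a unit multiple of `T` for `p ≠ 2`) it contains `ℬ` and `𝒜` modulo `Y²Λ`, hence the constant
`D := (M₂+M₃)·𝒜 − M₂·ℬ = M₀(M₂+M₃) − M₁M₂` modulo `Y²Λ`; and if `M₂` is a unit and `p^s ∣ M₀`, then `Y ∈ 𝔭 + p^sΛ` (from `𝒜`),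
so `Y²Λ ⊆ 𝔭 + p^{2s}Λ` and `D ∈ 𝔭 + p^{2s}Λ`: **`p^{2s} ∤ D` forces `p ∈ 𝔭`.** In Newton-polygon terms: `M = A(Y) + T·B(Y)`,
a common zero of `M, M∘ι` off `(T)` is a common zero `y` of `A, B` with `v(y) = v(M₀) = s`, and `D = A₀B₁ − A₁B₀` is the
degree-one resultant — the ι-trace split HALVES the Weierstrass degrees (`λ(M) = 2 ↦ (1, 1)`), so the certificate needs
`2s` digits where the `T`-resultant of the two conjugate quadratics needs about twice as many. This is the degree-one case
of the programme whose degree-two case is w2 g5's `pow_three_dvd_of_selfDualQuad_dvd` (`N_A(σ) = A(σ)`, `N_B(σ) = B(σ)`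
truncated at `σ³`).

## Contents (namespace `…Theorems.ChromaticIotaTrace`)

* §1 identities for `Y = T + ι(T)`: `traceY_mul_one_add_X` (`Y(1+T) = T²`), `X_mul_iota_eq_neg_traceY` (`T·ι(T) = −Y`),
  `X_sub_iota_eq` (`T − ι(T) = T·(2 + ι(T))`), `isUnit_two_add_iota` (`p ≠ 2`), `X_pow_four_mem_span_traceY_sq`,
  `coe_poly₄` / `subst_iota_poly₄` / `X_pow_five_dvd_sub_poly₄` (the degree-`4` Taylor polynomial and its ι-image).
* §2 **`natCast_mem_of_iotaTraceLinear`**: `𝔭` prime, `T ∉ 𝔭`, `M, M∘ι ∈ 𝔭`, `IsUnit M₂`, `p^s ∣ M₀`,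
  `¬ p^{2s} ∣ M₀(M₂+M₃) − M₁M₂` ⟹ `(p : Λ) ∈ 𝔭`; contrapositives `not_mem_and_mem_of_iotaTraceLinear` (primes off `(p)`, `(T)`)
  and the `T`-shifted `not_mem_and_mem_of_X_mul_of_iotaTraceLinear` (`L = T·M`: the datum reads on `L₁, …, L₄`).

References (ATTRIBUTION): [GreenbergLNM1716] R. Greenberg, LNM 1716 (1999), §1 (the involution `T^ι`), §5 (root pairing);
[MazurTateTeitelbaum1986Invent] Ch. I §17; [Washington1997] §7.1, §13.2; [AtiyahMacdonald1969] Prop. 1.9. Tree: `…IotaDescentAlgebra`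
(`one_add_X_mul_iota`, `isUnit_one_add_of_mem_maximalIdeal`, `mem_maximalIdeal_iff_natCast_dvd`), `…IotaDescent`
(`two_not_mem_maximalIdeal`), `Literature/Barriers/…/PAdicFunctionalEquationParity` (`invOnePlusSubOne`, `hasSubst_invOnePlusSubOne`,
`invOnePlusSubOne_eq_neg_X_mul`, `constantCoeff_invOnePlusSubOne`).
-/

set_option linter.dupNamespace false
set_option autoImplicit false

noncomputable section

open scoped Classical Polynomial

open Literature.NumberTheory.EllipticCurves Literature.Barriers.BirchSwinnertonDyer
  Summit.BirchSwinnertonDyer.BirchSwinnertonDyer.Theorems.ChromaticIotaDescent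

namespace Summit.BirchSwinnertonDyer.BirchSwinnertonDyer.Theorems.ChromaticIotaTrace

variable {p : ℕ} [hp : Fact p.Prime]

/-! ### §1 The ι-invariant `Y = T + ι(T)` and the degree-four Taylor polynomial -/

/-- `Y·(1+T) = T²` for `Y = T + ι(T)`. [cite: GreenbergLNM1716, §1] -/
theorem traceY_mul_one_add_X :
    (PowerSeries.X + invOnePlusSubOne : IwasawaAlgebra p) * (1 + PowerSeries.X) = PowerSeries.X ^ 2 := by
  linear_combination one_add_X_mul_iota (p := p)

/-- `T·ι(T) = −Y`. [cite: GreenbergLNM1716, §1] -/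
theorem X_mul_iota_eq_neg_traceY :
    (PowerSeries.X : IwasawaAlgebra p) * invOnePlusSubOne = -(PowerSeries.X + invOnePlusSubOne) := by
  linear_combination one_add_X_mul_iota (p := p)

/-- `T − ι(T) = T·(2 + ι(T))`. [folklore] -/
theorem X_sub_iota_eq :
    (PowerSeries.X : IwasawaAlgebra p) - invOnePlusSubOne = PowerSeries.X * (2 + invOnePlusSubOne) := by
  linear_combination -(one_add_X_mul_iota (p := p))

/-- `2 + ι(T)` is a unit of `Λ` when `p ≠ 2` (its constant term is `2`). [folklore] -/
theorem isUnit_two_add_iota (hp2 : p ≠ 2) : IsUnit (2 + invOnePlusSubOne : IwasawaAlgebra p) := by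
  rw [PowerSeries.isUnit_iff_constantCoeff, map_add, constantCoeff_invOnePlusSubOne, add_zero, map_ofNat]
  by_contra hnu
  exact two_not_mem_maximalIdeal hp2 ((IsLocalRing.mem_maximalIdeal _).mpr (mem_nonunits_iff.mpr hnu))

/-- `T⁴ = Y²(1+T)²`, so `T⁴ ∈ Y²Λ`. [folklore] -/
theorem X_pow_four_mem_span_traceY_sq :
    (PowerSeries.X : IwasawaAlgebra p) ^ 4 ∈ Ideal.span {(PowerSeries.X + invOnePlusSubOne : IwasawaAlgebra p) ^ 2} := by
  refine Ideal.mem_span_singleton'.mpr ⟨(1 + PowerSeries.X) ^ 2, ?_⟩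
  have h := traceY_mul_one_add_X (p := p)
  linear_combination ((PowerSeries.X + invOnePlusSubOne) * (1 + PowerSeries.X) + PowerSeries.X ^ 2) * h

/-- `1 − Y·a` is a unit of `Λ` for every `a` (`Y` has zero constant term). [folklore] -/
theorem isUnit_one_sub_traceY_mul (a : IwasawaAlgebra p) :
    IsUnit (1 - (PowerSeries.X + invOnePlusSubOne) * a) := by
  rw [PowerSeries.isUnit_iff_constantCoeff, map_sub, map_one, map_mul, map_add, PowerSeries.constantCoeff_X,
    constantCoeff_invOnePlusSubOne, add_zero, zero_mul, sub_zero]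
  exact isUnit_one

/-- Membership is insensitive to unit factors: `w·x ∈ I`, `w` a unit ⟹ `x ∈ I`. [folklore] -/
theorem mem_of_isUnit_mul_mem {R : Type*} [CommRing R] {I : Ideal R} {w x : R} (hw : IsUnit w) (h : w * x ∈ I) :
    x ∈ I := by
  obtain ⟨u, rfl⟩ := hw
  have : (↑u⁻¹ : R) * (↑u * x) ∈ I := I.mul_mem_left _ h
  rwa [← mul_assoc, Units.inv_mul, one_mul] at this

/-- The degree-`4` Taylor polynomial, coerced into `Λ`. [folklore] -/
theorem coe_poly₄ (c0 c1 c2 c3 c4 : ℤ_[p]) :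
    ((Polynomial.C c0 + Polynomial.C c1 * Polynomial.X + Polynomial.C c2 * Polynomial.X ^ 2 +
        Polynomial.C c3 * Polynomial.X ^ 3 + Polynomial.C c4 * Polynomial.X ^ 4 : ℤ_[p][X]) : IwasawaAlgebra p) =
      PowerSeries.C c0 + PowerSeries.C c1 * PowerSeries.X + PowerSeries.C c2 * PowerSeries.X ^ 2 +
        PowerSeries.C c3 * PowerSeries.X ^ 3 + PowerSeries.C c4 * PowerSeries.X ^ 4 := by
  simp only [Polynomial.coe_add, Polynomial.coe_mul, Polynomial.coe_pow, Polynomial.coe_C, Polynomial.coe_X]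

/-- Its ι-image: `Σ c_k ι(T)^k`. [folklore] -/
theorem subst_iota_poly₄ (c0 c1 c2 c3 c4 : ℤ_[p]) :
    PowerSeries.subst (invOnePlusSubOne : IwasawaAlgebra p)
        ((Polynomial.C c0 + Polynomial.C c1 * Polynomial.X + Polynomial.C c2 * Polynomial.X ^ 2 +
          Polynomial.C c3 * Polynomial.X ^ 3 + Polynomial.C c4 * Polynomial.X ^ 4 : ℤ_[p][X]) : IwasawaAlgebra p) =
      PowerSeries.C c0 + PowerSeries.C c1 * invOnePlusSubOne + PowerSeries.C c2 * invOnePlusSubOne ^ 2 +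
        PowerSeries.C c3 * invOnePlusSubOne ^ 3 + PowerSeries.C c4 * invOnePlusSubOne ^ 4 := by
  have hι := hasSubst_invOnePlusSubOne (R := ℤ_[p])
  rw [PowerSeries.subst_coe hι]
  simp only [map_add, map_mul, map_pow, Polynomial.aeval_X, Polynomial.aeval_C, ← PowerSeries.C_eq_algebraMap]

/-- `T⁵` divides `M` minus its degree-`4` Taylor polynomial. [folklore] -/
theorem X_pow_five_dvd_sub_poly₄ (M : IwasawaAlgebra p) :
    (PowerSeries.X : IwasawaAlgebra p) ^ 5 ∣ M -
      (PowerSeries.C (PowerSeries.coeff 0 M) + PowerSeries.C (PowerSeries.coeff 1 M) * PowerSeries.X +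
        PowerSeries.C (PowerSeries.coeff 2 M) * PowerSeries.X ^ 2 + PowerSeries.C (PowerSeries.coeff 3 M) * PowerSeries.X ^ 3 +
        PowerSeries.C (PowerSeries.coeff 4 M) * PowerSeries.X ^ 4) := by
  rw [PowerSeries.X_pow_dvd_iff]
  intro m hm
  rw [← pow_one (PowerSeries.X : IwasawaAlgebra p)]
  simp only [map_sub, map_add, PowerSeries.coeff_C, PowerSeries.coeff_C_mul_X_pow]
  interval_cases m <;> simp

/-! ### §2 The degree-one ι-trace resultant -/

/-- **THE DEGREE-ONE ι-TRACE RESULTANT.** Let `p ≠ 2`, `M ∈ Λ = ℤ_p⟦T⟧` with coefficients `M₀, …, M₃`, `𝔭` a prime ideal with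
`T ∉ 𝔭` containing `M` and `M∘ι`. If `M₂` is a unit, `p^s ∣ M₀` and `p^{2s} ∤ D := M₀(M₂+M₃) − M₁M₂`, then `p ∈ 𝔭`.
(`ℬ = M₁ + (M₂+M₃)Y` and `𝒜 = M₀ + M₂Y` lie in `𝔭 + Y²Λ`, `Y ∈ 𝔭 + p^sΛ`, so `D = (M₂+M₃)𝒜 − M₂ℬ ∈ 𝔭 + p^{2s}Λ`, and
`D = p^d·unit` with `d < 2s`.) [cite: GreenbergLNM1716, §1 and §5] [cite: AtiyahMacdonald1969, Prop. 1.9] -/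
theorem natCast_mem_of_iotaTraceLinear (hp2 : p ≠ 2) {M : IwasawaAlgebra p} {𝔭 : Ideal (IwasawaAlgebra p)}
    (h𝔭 : 𝔭.IsPrime) (hT : (PowerSeries.X : IwasawaAlgebra p) ∉ 𝔭) (hM : M ∈ 𝔭)
    (hιM : PowerSeries.subst (invOnePlusSubOne : IwasawaAlgebra p) M ∈ 𝔭)
    (hM2 : IsUnit (PowerSeries.coeff 2 M)) {s : ℕ} (hs : (p : ℤ_[p]) ^ s ∣ PowerSeries.coeff 0 M)
    (hD : ¬ (p : ℤ_[p]) ^ (2 * s) ∣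
      PowerSeries.coeff 0 M * (PowerSeries.coeff 2 M + PowerSeries.coeff 3 M) -
        PowerSeries.coeff 1 M * PowerSeries.coeff 2 M) :
    ((p : ℕ) : IwasawaAlgebra p) ∈ 𝔭 := by
  have hι := hasSubst_invOnePlusSubOne (R := ℤ_[p])
  -- opaque names for `Y`, the coefficients and the constant `D`
  obtain ⟨Y, hY⟩ : ∃ Y : IwasawaAlgebra p, Y = PowerSeries.X + invOnePlusSubOne := ⟨_, rfl⟩
  obtain ⟨c0, hc0⟩ : ∃ c, c = PowerSeries.coeff 0 M := ⟨_, rfl⟩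
  obtain ⟨c1, hc1⟩ : ∃ c, c = PowerSeries.coeff 1 M := ⟨_, rfl⟩
  obtain ⟨c2, hc2⟩ : ∃ c, c = PowerSeries.coeff 2 M := ⟨_, rfl⟩
  obtain ⟨c3, hc3⟩ : ∃ c, c = PowerSeries.coeff 3 M := ⟨_, rfl⟩
  obtain ⟨c4, hc4⟩ : ∃ c, c = PowerSeries.coeff 4 M := ⟨_, rfl⟩
  rw [← hc0, ← hc1, ← hc2, ← hc3] at hD
  rw [← hc0] at hs
  rw [← hc2] at hM2
  obtain ⟨D, hDdef⟩ : ∃ D : ℤ_[p], D = c0 * (c2 + c3) - c1 * c2 := ⟨_, rfl⟩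
  rw [← hDdef] at hD
  have hrel : (1 + PowerSeries.X) * (invOnePlusSubOne : IwasawaAlgebra p) = -PowerSeries.X := one_add_X_mul_iota
  have hYT : Y * (1 + PowerSeries.X) = PowerSeries.X ^ 2 := by rw [hY]; exact traceY_mul_one_add_X
  have hT4 : (PowerSeries.X : IwasawaAlgebra p) ^ 4 ∈ Ideal.span {Y ^ 2} := by rw [hY]; exact X_pow_four_mem_span_traceY_sq
  -- (1) Taylor: `M = S + T⁵·V₁`, `M∘ι = ιS + ι(T)⁵·ι(V₁)`
  obtain ⟨V₁, hV₁⟩ := X_pow_five_dvd_sub_poly₄ M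
  rw [← hc0, ← hc1, ← hc2, ← hc3, ← hc4] at hV₁
  have hMeq : M = ((Polynomial.C c0 + Polynomial.C c1 * Polynomial.X + Polynomial.C c2 * Polynomial.X ^ 2 +
      Polynomial.C c3 * Polynomial.X ^ 3 + Polynomial.C c4 * Polynomial.X ^ 4 : ℤ_[p][X]) : IwasawaAlgebra p) +
      PowerSeries.X ^ 5 * V₁ := by
    rw [coe_poly₄, ← hV₁]; ring
  have hιMeq : PowerSeries.subst (invOnePlusSubOne : IwasawaAlgebra p) M =
      (PowerSeries.C c0 + PowerSeries.C c1 * invOnePlusSubOne + PowerSeries.C c2 * invOnePlusSubOne ^ 2 +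
        PowerSeries.C c3 * invOnePlusSubOne ^ 3 + PowerSeries.C c4 * invOnePlusSubOne ^ 4) +
      invOnePlusSubOne ^ 5 * PowerSeries.subst (invOnePlusSubOne : IwasawaAlgebra p) V₁ := by
    conv_lhs => rw [hMeq]
    rw [PowerSeries.subst_add hι, PowerSeries.subst_mul hι, PowerSeries.subst_pow hι, PowerSeries.subst_X hι,
      subst_iota_poly₄]
  have hMeq' : M = (PowerSeries.C c0 + PowerSeries.C c1 * PowerSeries.X + PowerSeries.C c2 * PowerSeries.X ^ 2 +
      PowerSeries.C c3 * PowerSeries.X ^ 3 + PowerSeries.C c4 * PowerSeries.X ^ 4) + PowerSeries.X ^ 5 * V₁ := by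
    rw [← coe_poly₄]; exact hMeq
  -- (2) `M − M∘ι = T·((2+ι)·W + T⁴·R)` with `W` the ι-symmetric quotient
  obtain ⟨W, hW⟩ : ∃ W : IwasawaAlgebra p, W = PowerSeries.C c1 + PowerSeries.C c2 * (PowerSeries.X + invOnePlusSubOne) +
      PowerSeries.C c3 * (PowerSeries.X ^ 2 + PowerSeries.X * invOnePlusSubOne + invOnePlusSubOne ^ 2) +
      PowerSeries.C c4 * (PowerSeries.X ^ 3 + PowerSeries.X ^ 2 * invOnePlusSubOne + PowerSeries.X * invOnePlusSubOne ^ 2 +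
        invOnePlusSubOne ^ 3) := ⟨_, rfl⟩
  have he5 : (invOnePlusSubOne : IwasawaAlgebra p) ^ 5 = -(PowerSeries.X ^ 5 * (invOnePlusSubOne + 1) ^ 5) := by
    have h := invOnePlusSubOne_eq_neg_X_mul (R := ℤ_[p])
    have : (invOnePlusSubOne : IwasawaAlgebra p) = -(PowerSeries.X * (invOnePlusSubOne + 1)) := by
      linear_combination h
    conv_lhs => rw [this]
    ring
  have hdiff : M - PowerSeries.subst (invOnePlusSubOne : IwasawaAlgebra p) M =
      PowerSeries.X * ((2 + invOnePlusSubOne) * W +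
        PowerSeries.X ^ 4 * (V₁ + (invOnePlusSubOne + 1) ^ 5 * PowerSeries.subst (invOnePlusSubOne : IwasawaAlgebra p) V₁)) := by
    rw [hιMeq, he5]
    conv_lhs => rw [hMeq']
    linear_combination (-(PowerSeries.X - invOnePlusSubOne)) * hW + (-W) * hrel
  have hin : (2 + invOnePlusSubOne) * W +
      PowerSeries.X ^ 4 * (V₁ + (invOnePlusSubOne + 1) ^ 5 * PowerSeries.subst (invOnePlusSubOne : IwasawaAlgebra p) V₁) ∈ 𝔭 := by
    have h1 : M - PowerSeries.subst (invOnePlusSubOne : IwasawaAlgebra p) M ∈ 𝔭 := 𝔭.sub_mem hM hιM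
    rw [hdiff] at h1
    exact (h𝔭.mem_or_mem h1).resolve_left hT
  have hWmem : W ∈ 𝔭 ⊔ Ideal.span {Y ^ 2} := by
    refine mem_of_isUnit_mul_mem (isUnit_two_add_iota hp2) ?_
    have : (2 + invOnePlusSubOne) * W = ((2 + invOnePlusSubOne) * W +
        PowerSeries.X ^ 4 * (V₁ + (invOnePlusSubOne + 1) ^ 5 * PowerSeries.subst (invOnePlusSubOne : IwasawaAlgebra p) V₁)) -
        PowerSeries.X ^ 4 * (V₁ + (invOnePlusSubOne + 1) ^ 5 * PowerSeries.subst (invOnePlusSubOne : IwasawaAlgebra p) V₁) := by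
      ring
    rw [this]
    exact Ideal.sub_mem _ (Ideal.mem_sup_left hin) (Ideal.mem_sup_right (Ideal.mul_mem_right _ _ hT4))
  -- (3) the linear parts `ℬ = c₁ + (c₂+c₃)Y`, `𝒜 = c₀ + c₂Y` lie in `𝔭 + Y²Λ`
  obtain ⟨ℬ, hℬ⟩ : ∃ B : IwasawaAlgebra p, B = PowerSeries.C c1 + PowerSeries.C (c2 + c3) * Y := ⟨_, rfl⟩
  obtain ⟨𝒜, h𝒜⟩ : ∃ A : IwasawaAlgebra p, A = PowerSeries.C c0 + PowerSeries.C c2 * Y := ⟨_, rfl⟩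
  have hWℬ : W - ℬ = Y ^ 2 * (PowerSeries.C c3 + PowerSeries.C c4 * (Y + 2)) := by
    rw [hW, hℬ, hY, map_add]
    linear_combination (-(PowerSeries.C c3 + 2 * (PowerSeries.X + invOnePlusSubOne) * PowerSeries.C c4)) * hrel
  have hℬmem : ℬ ∈ 𝔭 ⊔ Ideal.span {Y ^ 2} := by
    have : ℬ = W - Y ^ 2 * (PowerSeries.C c3 + PowerSeries.C c4 * (Y + 2)) := by rw [← hWℬ]; ring
    rw [this]
    exact Ideal.sub_mem _ hWmem (Ideal.mem_sup_right (Ideal.mul_mem_right _ _ (Ideal.mem_span_singleton_self _)))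
  have hS𝒜ℬ : (PowerSeries.C c0 + PowerSeries.C c1 * PowerSeries.X + PowerSeries.C c2 * PowerSeries.X ^ 2 +
      PowerSeries.C c3 * PowerSeries.X ^ 3 + PowerSeries.C c4 * PowerSeries.X ^ 4) - 𝒜 - PowerSeries.X * ℬ =
      Y ^ 2 * (PowerSeries.C c3 * (1 + PowerSeries.X) + PowerSeries.C c4 * (1 + PowerSeries.X) ^ 2) := by
    rw [h𝒜, hℬ, map_add]
    linear_combination (-(PowerSeries.C c2) - PowerSeries.C c3 * (Y + PowerSeries.X) -
      PowerSeries.C c4 * (Y * (1 + PowerSeries.X) + PowerSeries.X ^ 2)) * hYT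
  have h𝒜mem : 𝒜 ∈ 𝔭 ⊔ Ideal.span {Y ^ 2} := by
    have hT5 : PowerSeries.X ^ 5 * V₁ ∈ Ideal.span {Y ^ 2} := by
      have : (PowerSeries.X : IwasawaAlgebra p) ^ 5 * V₁ = PowerSeries.X ^ 4 * (PowerSeries.X * V₁) := by ring
      rw [this]; exact Ideal.mul_mem_right _ _ hT4
    have h𝒜eq : 𝒜 = M - PowerSeries.X ^ 5 * V₁ - PowerSeries.X * ℬ -
        ((PowerSeries.C c0 + PowerSeries.C c1 * PowerSeries.X + PowerSeries.C c2 * PowerSeries.X ^ 2 +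
          PowerSeries.C c3 * PowerSeries.X ^ 3 + PowerSeries.C c4 * PowerSeries.X ^ 4) - 𝒜 - PowerSeries.X * ℬ) := by
      rw [hMeq']; ring
    rw [h𝒜eq]
    refine Ideal.sub_mem _ (Ideal.sub_mem _ (Ideal.sub_mem _ (Ideal.mem_sup_left hM) (Ideal.mem_sup_right hT5))
      (Ideal.mul_mem_left _ _ hℬmem)) (Ideal.mem_sup_right ?_)
    rw [hS𝒜ℬ]
    exact Ideal.mul_mem_right _ _ (Ideal.mem_span_singleton_self _)
  -- (4) `Y ∈ 𝔭 + p^sΛ`: `C c₂ · Y = 𝒜 − C c₀`, `c₂` a unit, `p^s ∣ c₀`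
  obtain ⟨u2, hu2⟩ := hM2
  obtain ⟨c0', hc0'⟩ := hs
  have hYmem : Y ∈ 𝔭 ⊔ Ideal.span {(PowerSeries.C ((p : ℤ_[p]) ^ s) : IwasawaAlgebra p)} := by
    have h1 : PowerSeries.C (u2 : ℤ_[p]) * Y ∈ (𝔭 ⊔ Ideal.span {Y ^ 2}) ⊔
        Ideal.span {(PowerSeries.C ((p : ℤ_[p]) ^ s) : IwasawaAlgebra p)} := by
      have : PowerSeries.C (u2 : ℤ_[p]) * Y = 𝒜 - PowerSeries.C ((p : ℤ_[p]) ^ s) * PowerSeries.C c0' := by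
        rw [h𝒜, hu2, hc0', map_mul]; ring
      rw [this]
      exact Ideal.sub_mem _ (Ideal.mem_sup_left h𝒜mem)
        (Ideal.mem_sup_right (Ideal.mul_mem_right _ _ (Ideal.mem_span_singleton_self _)))
    have h2 := mem_of_isUnit_mul_mem ((Units.isUnit u2).map PowerSeries.C) h1
    obtain ⟨qa, hqa, r, hr, hqar⟩ := Submodule.mem_sup.mp h2
    obtain ⟨q, hq, ya, hya, hqya⟩ := Submodule.mem_sup.mp hqa
    obtain ⟨a, rfl⟩ := Ideal.mem_span_singleton'.mp hya
    have hYexp : Y = q + a * Y ^ 2 + r := by rw [hqya]; exact hqar.symm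
    have hYeq : (1 - Y * a) * Y = q + r := by linear_combination hYexp
    have h3 : (1 - Y * a) * Y ∈ 𝔭 ⊔ Ideal.span {(PowerSeries.C ((p : ℤ_[p]) ^ s) : IwasawaAlgebra p)} := by
      rw [hYeq]; exact Ideal.add_mem _ (Ideal.mem_sup_left hq) (Ideal.mem_sup_right hr)
    have hu : IsUnit (1 - Y * a) := by rw [hY]; exact isUnit_one_sub_traceY_mul (p := p) a
    exact mem_of_isUnit_mul_mem hu h3
  -- (5) `Y² ∈ 𝔭 + p^{2s}Λ`, so `𝔭 + Y²Λ ≤ 𝔭 + p^{2s}Λ` and `C D ∈ 𝔭 + p^{2s}Λ`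
  have hY2 : Y ^ 2 ∈ 𝔭 ⊔ Ideal.span {(PowerSeries.C ((p : ℤ_[p]) ^ (2 * s)) : IwasawaAlgebra p)} := by
    obtain ⟨q, hq, r, hr, hqr⟩ := Submodule.mem_sup.mp hYmem
    obtain ⟨b, rfl⟩ := Ideal.mem_span_singleton'.mp hr
    have : Y ^ 2 = q * (q + 2 * (b * PowerSeries.C ((p : ℤ_[p]) ^ s))) +
        b ^ 2 * PowerSeries.C ((p : ℤ_[p]) ^ (2 * s)) := by
      rw [← hqr, show 2 * s = s + s from two_mul s, pow_add, map_mul]; ring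
    rw [this]
    exact Ideal.add_mem _ (Ideal.mem_sup_left (Ideal.mul_mem_right _ _ hq))
      (Ideal.mem_sup_right (Ideal.mul_mem_left _ _ (Ideal.mem_span_singleton_self _)))
  have hle : 𝔭 ⊔ Ideal.span {Y ^ 2} ≤ 𝔭 ⊔ Ideal.span {(PowerSeries.C ((p : ℤ_[p]) ^ (2 * s)) : IwasawaAlgebra p)} :=
    sup_le le_sup_left ((Ideal.span_singleton_le_iff_mem _).mpr hY2)
  have hCD : (PowerSeries.C D : IwasawaAlgebra p) ∈
      𝔭 ⊔ Ideal.span {(PowerSeries.C ((p : ℤ_[p]) ^ (2 * s)) : IwasawaAlgebra p)} := by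
    have : (PowerSeries.C D : IwasawaAlgebra p) = PowerSeries.C (c2 + c3) * 𝒜 - PowerSeries.C c2 * ℬ := by
      rw [hDdef, h𝒜, hℬ, map_add, map_sub, map_mul, map_mul, map_add]; ring
    rw [this]
    exact hle (Ideal.sub_mem _ (Ideal.mul_mem_left _ _ h𝒜mem) (Ideal.mul_mem_left _ _ hℬmem))
  -- (6) `D = p^d · t`, `t` a unit, `d < 2s` ⟹ `p^d ∈ 𝔭` ⟹ `p ∈ 𝔭`
  have hD0 : D ≠ 0 := fun h => hD (by rw [h]; exact dvd_zero _)
  have hdlt : D.valuation < 2 * s := by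
    by_contra hge
    rw [not_lt] at hge
    exact hD (Ideal.mem_span_singleton.mp ((PadicInt.mem_span_pow_iff_le_valuation D hD0 (2 * s)).mpr hge))
  have hDeq : D = (PadicInt.unitCoeff hD0 : ℤ_[p]) * (p : ℤ_[p]) ^ D.valuation := PadicInt.unitCoeff_spec hD0
  obtain ⟨q, hq, r, hr, hqr⟩ := Submodule.mem_sup.mp hCD
  obtain ⟨b, rfl⟩ := Ideal.mem_span_singleton'.mp hr
  obtain ⟨k, hk⟩ := Nat.exists_eq_add_of_lt hdlt
  have hqeq : q = PowerSeries.C ((p : ℤ_[p]) ^ D.valuation) *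
      (PowerSeries.C ((PadicInt.unitCoeff hD0 : ℤ_[p]ˣ) : ℤ_[p]) - PowerSeries.C ((p : ℤ_[p]) ^ (k + 1)) * b) := by
    have h1 : q = PowerSeries.C D - b * PowerSeries.C ((p : ℤ_[p]) ^ (2 * s)) := by rw [← hqr]; ring
    rw [h1]
    conv_lhs => rw [hDeq, hk, show D.valuation + k + 1 = D.valuation + (k + 1) from add_assoc _ _ _]
    rw [pow_add, map_mul, map_mul]
    ring
  have hunit : IsUnit (PowerSeries.C ((PadicInt.unitCoeff hD0 : ℤ_[p]ˣ) : ℤ_[p]) -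
      PowerSeries.C ((p : ℤ_[p]) ^ (k + 1)) * b : IwasawaAlgebra p) := by
    rw [PowerSeries.isUnit_iff_constantCoeff, map_sub, map_mul, PowerSeries.constantCoeff_C, PowerSeries.constantCoeff_C]
    set t : ℤ_[p]ˣ := PadicInt.unitCoeff hD0
    have hm : (p : ℤ_[p]) ^ (k + 1) * PowerSeries.constantCoeff b ∈ IsLocalRing.maximalIdeal ℤ_[p] := by
      rw [mem_maximalIdeal_iff_natCast_dvd]
      exact Dvd.dvd.mul_right (dvd_pow_self _ (Nat.succ_ne_zero k)) _
    have : (t : ℤ_[p]) - (p : ℤ_[p]) ^ (k + 1) * PowerSeries.constantCoeff b =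
        (t : ℤ_[p]) * (1 + ((t⁻¹ : ℤ_[p]ˣ) : ℤ_[p]) * -((p : ℤ_[p]) ^ (k + 1) * PowerSeries.constantCoeff b)) := by
      rw [mul_add, mul_one, ← mul_assoc, Units.mul_inv, one_mul]; ring
    rw [this]
    exact (Units.isUnit t).mul (isUnit_one_add_of_mem_maximalIdeal
      (Ideal.mul_mem_left _ _ ((IsLocalRing.maximalIdeal ℤ_[p]).neg_mem hm)))
  have hpd : (PowerSeries.C ((p : ℤ_[p]) ^ D.valuation) : IwasawaAlgebra p) ∈ 𝔭 := by
    have h1 : (PowerSeries.C ((PadicInt.unitCoeff hD0 : ℤ_[p]ˣ) : ℤ_[p]) - PowerSeries.C ((p : ℤ_[p]) ^ (k + 1)) * b) *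
        PowerSeries.C ((p : ℤ_[p]) ^ D.valuation) ∈ 𝔭 := by
      rw [mul_comm, ← hqeq]; exact hq
    exact mem_of_isUnit_mul_mem hunit h1
  rw [map_pow, map_natCast] at hpd
  exact h𝔭.mem_of_pow_mem _ hpd

/-- **No ι-pair off `(p)` and `(T)`** under the degree-one ι-trace certificate (contrapositive for points of `Spec Λ`).
[cite: GreenbergLNM1716, §1 and §5] -/
theorem not_mem_and_mem_of_iotaTraceLinear (hp2 : p ≠ 2) {M : IwasawaAlgebra p}
    (hM2 : IsUnit (PowerSeries.coeff 2 M)) {s : ℕ} (hs : (p : ℤ_[p]) ^ s ∣ PowerSeries.coeff 0 M)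
    (hD : ¬ (p : ℤ_[p]) ^ (2 * s) ∣
      PowerSeries.coeff 0 M * (PowerSeries.coeff 2 M + PowerSeries.coeff 3 M) -
        PowerSeries.coeff 1 M * PowerSeries.coeff 2 M)
    (𝔭 : PrimeSpectrum (IwasawaAlgebra p)) (hp𝔭 : ((p : ℕ) : IwasawaAlgebra p) ∉ 𝔭.asIdeal)
    (hT : (PowerSeries.X : IwasawaAlgebra p) ∉ 𝔭.asIdeal) :
    ¬ (M ∈ 𝔭.asIdeal ∧ PowerSeries.subst (invOnePlusSubOne : IwasawaAlgebra p) M ∈ 𝔭.asIdeal) := fun h =>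
  hp𝔭 (natCast_mem_of_iotaTraceLinear hp2 𝔭.isPrime hT h.1 h.2 hM2 hs hD)

/-- **The `T`-shifted form** (analytic rank one): for `L = T·M` the coefficients of `M` are `M_k = L_{k+1}`, and
`L∘ι = ι(T)·(M∘ι)` with `ι(T) ∉ 𝔭` when `T ∉ 𝔭`; so the datum `IsUnit L₃`, `p^s ∣ L₁`, `p^{2s} ∤ L₁(L₃+L₄) − L₂L₃`
excludes every prime `𝔭 ∌ p, T` containing `L` and `L∘ι`. [cite: GreenbergLNM1716, §1 and §5] -/
theorem not_mem_and_mem_of_X_mul_of_iotaTraceLinear (hp2 : p ≠ 2) {L M : IwasawaAlgebra p}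
    (hLM : L = PowerSeries.X * M) (hL3 : IsUnit (PowerSeries.coeff 3 L)) {s : ℕ}
    (hs : (p : ℤ_[p]) ^ s ∣ PowerSeries.coeff 1 L)
    (hD : ¬ (p : ℤ_[p]) ^ (2 * s) ∣
      PowerSeries.coeff 1 L * (PowerSeries.coeff 3 L + PowerSeries.coeff 4 L) -
        PowerSeries.coeff 2 L * PowerSeries.coeff 3 L)
    (𝔭 : PrimeSpectrum (IwasawaAlgebra p)) (hp𝔭 : ((p : ℕ) : IwasawaAlgebra p) ∉ 𝔭.asIdeal)
    (hT : (PowerSeries.X : IwasawaAlgebra p) ∉ 𝔭.asIdeal) :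
    ¬ (L ∈ 𝔭.asIdeal ∧ PowerSeries.subst (invOnePlusSubOne : IwasawaAlgebra p) L ∈ 𝔭.asIdeal) := by
  have hι := hasSubst_invOnePlusSubOne (R := ℤ_[p])
  have hcoef : ∀ k, PowerSeries.coeff (k + 1) L = PowerSeries.coeff k M := by
    intro k; rw [hLM, PowerSeries.coeff_succ_X_mul]
  rw [hcoef 2] at hL3
  rw [hcoef 0] at hs
  rw [show (1 : ℕ) = 0 + 1 from rfl, show (3 : ℕ) = 2 + 1 from rfl, show (4 : ℕ) = 3 + 1 from rfl,
    show (2 : ℕ) = 1 + 1 from rfl, hcoef, hcoef, hcoef, hcoef] at hD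
  rintro ⟨hL, hιL⟩
  have hM : M ∈ 𝔭.asIdeal := by
    rw [hLM] at hL
    exact (𝔭.isPrime.mem_or_mem hL).resolve_left hT
  have hιM : PowerSeries.subst (invOnePlusSubOne : IwasawaAlgebra p) M ∈ 𝔭.asIdeal := by
    have h1 : PowerSeries.subst (invOnePlusSubOne : IwasawaAlgebra p) L =
        invOnePlusSubOne * PowerSeries.subst (invOnePlusSubOne : IwasawaAlgebra p) M := by
      rw [hLM, PowerSeries.subst_mul hι, PowerSeries.subst_X hι]
    rw [h1] at hιL
    refine (𝔭.isPrime.mem_or_mem hιL).resolve_left fun he => hT ?_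
    -- `ι(T) = −T·(1 + ι(T))` with `1 + ι(T)` a unit, so `ι(T) ∈ 𝔭 ⟹ T ∈ 𝔭`
    have hu : IsUnit (invOnePlusSubOne + 1 : IwasawaAlgebra p) := by
      rw [PowerSeries.isUnit_iff_constantCoeff, map_add, map_one, constantCoeff_invOnePlusSubOne, zero_add]
      exact isUnit_one
    have h2 : (invOnePlusSubOne + 1) * (-PowerSeries.X : IwasawaAlgebra p) ∈ 𝔭.asIdeal := by
      have h3 : (invOnePlusSubOne + 1) * (-PowerSeries.X : IwasawaAlgebra p) = invOnePlusSubOne := by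
        have h := invOnePlusSubOne_eq_neg_X_mul (R := ℤ_[p])
        linear_combination -h
      rw [h3]; exact he
    exact (𝔭.asIdeal.neg_mem_iff).mp (mem_of_isUnit_mul_mem hu h2)
  exact not_mem_and_mem_of_iotaTraceLinear hp2 hL3 hs hD 𝔭 hp𝔭 hT ⟨hM, hιM⟩

end Summit.BirchSwinnertonDyer.BirchSwinnertonDyer.Theorems.ChromaticIotaTrace

end
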